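import Mathlib
import Summits.PneNP.PneNP.Theorems.PstarGapLemma
import Summits.PneNP.PneNP.Theorems.PstarSAClosure

/-!
# Peeling: boundary-expanding pure `P⋆` systems are `r`-feasible with no parity constraints (ROUND-24 item T24.8a)

FRONTIER range-avoidance ladder (cell `pnp-ideate`, ROUND-24 gap-lemma programme `PstarGapLemma`, item T24.8a; restricted-model
combinatorics — nothing here bears on `P` versus `NP`).

The `|W| = 0` case of the gap lemma, by the classical peeling argument: if `I` is a pure `P⋆ = u₀ ⊕ u₁ ⊕ u₂u₃` instance (tables
`xorAndPred`, injective positions) that is `(r, 3/2)`-boundary expanding, then every set `J` of at most `r` outputs is satisfiable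
for EVERY target `y` (`feasible_of_boundaryExpanding`, `rFeasible_empty : RFeasible I y r ∅`): a nonempty `J` has
`|bdry J| ≥ (3/2)|J| > |J|`, so (`PstarSAClosure.exists_two_private`) some output `j ∈ J` owns two private variables; satisfy
`J ∖ {j}` by induction and repair output `j` on its private variables — flip a private XOR slot, or, if both private variables are
the AND slots, set them to `(c, c)` with `c = y_j ⊕ u₀ ⊕ u₁`.  Hence `eq_empty_of_minInfeasible_empty`: a minimal `∅`-infeasible set
of at most `r` outputs is empty — `GapBound K r` is never violated at `W = ∅`.  No typedness is used.
-/

set_option linter.dupNamespace false -- `Summit.PneNP.PneNP.…`: summit = sub-problem name (D-0017 single-conjunct layout)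

open Finset Literature.Computability.Complexity
open Summit.PneNP.PneNP.Theorems.PstarSALevel (varSet bdry BoundaryExpanding)
open Summit.PneNP.PneNP.Theorems.PstarSAClosure (exists_two_private mem_bdry_iff degIn)
open Summit.PneNP.PneNP.Theorems.PstarGapLemma (Sat Feasible MinInfeasible RFeasible sat_empty)

namespace Summit.PneNP.PneNP.Theorems.PstarGapPeeling

variable {n m : ℕ}

/-! ## Private variables and local repairs -/

/-- Outputs read only their own variables: assignments agreeing on `varSet I j` give the same value at `j`. -/
theorem eval_congr (I : LocalMap 4 n m) (j : Fin m) {z z' : Fin n → Bool} (h : ∀ s : Fin 4, z (I.vars j s) = z' (I.vars j s)) :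
    I.eval z j = I.eval z' j := by
  unfold LocalMap.eval
  congr 1
  funext s
  exact h s

/-- A private variable of `j` in `J` (a boundary variable read by `j`) is read by no other output of `J`. -/
theorem not_mem_varSet_of_private (I : LocalMap 4 n m) {J : Finset (Fin m)} {j j' : Fin m} (hj : j ∈ J) (hj' : j' ∈ J)
    (hne : j' ≠ j) {v : Fin n} (hv : v ∈ bdry I J) (hvj : v ∈ varSet I j) : v ∉ varSet I j' := by
  intro hvj'
  rw [mem_bdry_iff] at hv
  unfold PstarSAClosure.degIn at hv
  have h2 : 2 ≤ (J.filter fun i => v ∈ varSet I i).card := by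
    have hsub : ({j, j'} : Finset (Fin m)) ⊆ J.filter fun i => v ∈ varSet I i := by
      intro i hi
      rw [mem_insert, mem_singleton] at hi
      rcases hi with rfl | rfl
      · exact mem_filter.2 ⟨hj, hvj⟩
      · exact mem_filter.2 ⟨hj', hvj'⟩
    have := card_le_card hsub
    rwa [card_pair hne.symm] at this
  omega

/-- Updating a variable not read by `j'` does not change output `j'`. -/
theorem eval_update_of_not_mem (I : LocalMap 4 n m) (j' : Fin m) (z : Fin n → Bool) {v : Fin n} (hv : v ∉ varSet I j') (b : Bool) :
    I.eval (Function.update z v b) j' = I.eval z j' := by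
  refine eval_congr I j' fun s => ?_
  rw [Function.update_of_ne]
  intro h
  exact hv (by rw [← h]; exact mem_image.2 ⟨s, mem_univ _, rfl⟩)

/-- The value of a pure `P⋆` output. -/
theorem eval_pure (I : LocalMap 4 n m) (hI : I.IsPure xorAndPred) (z : Fin n → Bool) (j : Fin m) :
    I.eval z j = xor (xor (z (I.vars j 0)) (z (I.vars j 1))) (z (I.vars j 2) && z (I.vars j 3)) := by
  unfold LocalMap.eval
  rw [hI.1 j, xorAndPred_apply]

/-- **Repair through a private XOR slot**: flipping the variable at slot `0` or `1` toggles output `j`. -/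
theorem eval_update_xor_slot (I : LocalMap 4 n m) (hI : I.IsPure xorAndPred) (z : Fin n → Bool) (j : Fin m) (s : Fin 4)
    (hs : s.val < 2) : I.eval (Function.update z (I.vars j s) (!z (I.vars j s))) j = !I.eval z j := by
  have hinj := hI.2 j
  have hne : ∀ t : Fin 4, t ≠ s → I.vars j t ≠ I.vars j s := fun t ht h => ht (hinj h)
  rw [eval_pure I hI, eval_pure I hI]
  have h01 : s = 0 ∨ s = 1 := by
    fin_cases s <;> simp at hs ⊢
  rcases h01 with rfl | rfl
  · rw [Function.update_self, Function.update_of_ne (hne 1 (by decide)), Function.update_of_ne (hne 2 (by decide)),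
      Function.update_of_ne (hne 3 (by decide))]
    cases z (I.vars j 0) <;> cases z (I.vars j 1) <;> cases (z (I.vars j 2) && z (I.vars j 3)) <;> rfl
  · rw [Function.update_self, Function.update_of_ne (hne 0 (by decide)), Function.update_of_ne (hne 2 (by decide)),
      Function.update_of_ne (hne 3 (by decide))]
    cases z (I.vars j 0) <;> cases z (I.vars j 1) <;> cases (z (I.vars j 2) && z (I.vars j 3)) <;> rfl

/-- **Repair through the AND pair**: setting both AND slots to `c` gives the value `u₀ ⊕ u₁ ⊕ c`. -/
theorem eval_update_and_pair (I : LocalMap 4 n m) (hI : I.IsPure xorAndPred) (z : Fin n → Bool) (j : Fin m) (c : Bool) :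
    I.eval (Function.update (Function.update z (I.vars j 2) c) (I.vars j 3) c) j =
      xor (xor (z (I.vars j 0)) (z (I.vars j 1))) c := by
  have hinj := hI.2 j
  have hne : ∀ t t' : Fin 4, t ≠ t' → I.vars j t ≠ I.vars j t' := fun t t' ht h => ht (hinj h)
  rw [eval_pure I hI]
  rw [Function.update_of_ne (hne 0 3 (by decide)), Function.update_of_ne (hne 0 2 (by decide)),
    Function.update_of_ne (hne 1 3 (by decide)), Function.update_of_ne (hne 1 2 (by decide)),
    Function.update_of_ne (hne 2 3 (by decide)), Function.update_self, Function.update_self, Bool.and_self]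

/-! ## Peeling -/

/-- **Feasibility by peeling**: on a pure `(r, 3/2)`-boundary expanding instance every set of at most `r` outputs is satisfiable,
for every target. -/
theorem feasible_of_boundaryExpanding (I : LocalMap 4 n m) (hI : I.IsPure xorAndPred) {r : ℕ} (hB : BoundaryExpanding r I)
    (y : Fin m → Bool) : ∀ J : Finset (Fin m), J.card ≤ r → ∃ z : Fin n → Bool, ∀ j ∈ J, I.eval z j = y j := by
  classical
  intro J
  induction J using Finset.strongInduction with
  | H J ih =>
    intro hJr
    rcases J.eq_empty_or_nonempty with rfl | hne
    · exact ⟨fun _ => false, fun j hj => absurd hj (notMem_empty _)⟩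
    -- an output with two private variables
    have hexp := hB J hJr
    have hpos : 0 < J.card := card_pos.2 hne
    have hlt : J.card < (bdry I J \ ∅).card := by rw [sdiff_empty]; omega
    obtain ⟨j, hj, hP⟩ := exists_two_private I J ∅ hlt
    rw [sdiff_empty] at hP
    set P := (bdry I J).filter fun v => v ∈ varSet I j with hPdef
    -- satisfy the rest
    obtain ⟨z₀, hz₀⟩ := ih (J.erase j) (erase_ssubset hj) ((card_erase_le).trans hJr)
    have hpriv : ∀ v ∈ P, ∀ j' ∈ J, j' ≠ j → v ∉ varSet I j' := fun v hv j' hj' hne' =>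
      not_mem_varSet_of_private I hj hj' hne' (mem_filter.1 hv).1 (mem_filter.1 hv).2
    -- every private variable is one of the four slot variables
    have hslot : ∀ v ∈ P, ∃ s : Fin 4, I.vars j s = v := fun v hv => by
      have := (mem_filter.1 hv).2
      unfold PstarSALevel.varSet at this
      obtain ⟨s, -, hs⟩ := mem_image.1 this
      exact ⟨s, hs⟩
    by_cases hx : ∃ s : Fin 4, s.val < 2 ∧ I.vars j s ∈ P
    · -- Case A: a private XOR slot — flip it if needed
      obtain ⟨s, hs, hsP⟩ := hx
      by_cases hok : I.eval z₀ j = y j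
      · exact ⟨z₀, fun j' hj' => if h : j' = j then by rw [h]; exact hok else hz₀ j' (mem_erase.2 ⟨h, hj'⟩)⟩
      refine ⟨Function.update z₀ (I.vars j s) (!z₀ (I.vars j s)), fun j' hj' => ?_⟩
      by_cases h : j' = j
      · subst h
        rw [eval_update_xor_slot I hI z₀ j' s hs]
        revert hok
        cases I.eval z₀ j' <;> cases y j' <;> simp
      · rw [eval_update_of_not_mem I j' z₀ (hpriv _ hsP j' hj' h)]
        exact hz₀ j' (mem_erase.2 ⟨h, hj'⟩)
    · -- Case B: both private variables are the AND slots
      push Not at hx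
      have hPsub : P ⊆ {I.vars j 2, I.vars j 3} := by
        intro v hv
        obtain ⟨s, rfl⟩ := hslot v hv
        rw [mem_insert, mem_singleton]
        have hs2 : 2 ≤ s.val := by
          by_contra hlt2
          push Not at hlt2
          exact hx s hlt2 hv
        have : s = 2 ∨ s = 3 := by fin_cases s <;> simp at hs2 ⊢
        rcases this with rfl | rfl
        · exact Or.inl rfl
        · exact Or.inr rfl
      have hPeq : P = {I.vars j 2, I.vars j 3} :=
        eq_of_subset_of_card_le hPsub ((card_insert_le _ _).trans (by rw [card_singleton]; exact hP))
      have h2P : I.vars j 2 ∈ P := by rw [hPeq]; simp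
      have h3P : I.vars j 3 ∈ P := by rw [hPeq]; simp
      set c := xor (xor (z₀ (I.vars j 0)) (z₀ (I.vars j 1))) (y j) with hc
      refine ⟨Function.update (Function.update z₀ (I.vars j 2) c) (I.vars j 3) c, fun j' hj' => ?_⟩
      by_cases h : j' = j
      · subst h
        rw [eval_update_and_pair I hI z₀ j' c, hc]
        cases z₀ (I.vars j' 0) <;> cases z₀ (I.vars j' 1) <;> cases y j' <;> rfl
      · rw [eval_update_of_not_mem I j' _ (hpriv _ h3P j' hj' h), eval_update_of_not_mem I j' _ (hpriv _ h2P j' hj' h)]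
        exact hz₀ j' (mem_erase.2 ⟨h, hj'⟩)

/-- **T24.8a — `r`-feasibility with no parity constraints.** -/
theorem rFeasible_empty (I : LocalMap 4 n m) (hI : I.IsPure xorAndPred) {r : ℕ} (hB : BoundaryExpanding r I) (y : Fin m → Bool) :
    RFeasible I y r (∅ : Finset (Finset (Fin n) × Bool)) := by
  intro J hJ
  obtain ⟨z, hz⟩ := feasible_of_boundaryExpanding I hI hB y J hJ
  exact ⟨z, sat_empty z, hz⟩

/-- **The `|W| = 0` case of the gap bound**: a minimal `∅`-infeasible set of at most `r` outputs is empty (indeed there is none). -/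
theorem eq_empty_of_minInfeasible_empty (I : LocalMap 4 n m) (hI : I.IsPure xorAndPred) {r : ℕ} (hB : BoundaryExpanding r I)
    {y : Fin m → Bool} {J : Finset (Fin m)} (hmin : MinInfeasible I y (∅ : Finset (Finset (Fin n) × Bool)) J) (hJ : J.card ≤ r) :
    J = ∅ :=
  absurd (rFeasible_empty I hI hB y J hJ) hmin.1

end Summit.PneNP.PneNP.Theorems.PstarGapPeeling
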